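import Summits.BirchSwinnertonDyer.BirchSwinnertonDyer.Theorems.PrintCFramBottomClassIndexLawFiveLeThetaCycleLegendreProduct
import Summits.BirchSwinnertonDyer.BirchSwinnertonDyer.Theorems.PrintCFramBottomClassIndexLawFiveLeHeegnerFieldSupplySeedOn
import Mathlib.Data.Nat.Squarefree
import HarnessLib

/-!
# Crux `PrintCFram.BottomClassIndexLawFiveLe` (stmt-BirchSwinnertonDyer-20372), line `eisenstein-resource-bdp-line` (registry v21):
# `stub_atP` ⟸ ONE HYPOTHESIS IN q-EXPANSION CURRENCY — the descent from a unit coefficient of the `m`-cut Cohen series in the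
# right Legendre class at `p` to an admissible imaginary quadratic field with `p` split and unit field factor
# (cell `bsd-print-cfram`, width seat `bsd-line-cfram-p1-w8` g6; THEOREMS ONLY, `--supports` 20372; BSD is not proved by any of this)

HONEST FRAMING. Nothing here is a statement about elliptic curves or BSD; no registered stub is closed. Registry v21's `stub_atP`
(= (AtP⁶), LEAD g12 p681058's `hAt`, «print-derivable, typing owed») says: for the class datum `(p, m, χ, k)` at the six leaf primes, a
unit field factor `p ∤ B_{k,(χε_{K₀})~}/k` at SOME imaginary quadratic `K₀` (`d_{K₀}` odd `< −4`, every `q ∣ m` split, any behaviour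
at `p`) propagates to such a field `K` in which moreover `p` SPLITS. The LEAD's derivation (lead-g12 §§3.1–3.4) = (T1) the `m`-cut
Cohen–Eisenstein series `G_e` times `θ₀(Q²z)^p` is a mod-`p` form of weight `k + (p+1)/2` and level prime to `p` whose coefficient at
`m·|d|·f²` is `T_f · (−B_{k,(χε_d)~}/k)` [Cohen 1975 Thm. 3.1, Shimura 1973 Prop. 1.5] + (T2)/(T3) Katz's filtration calculus + (T4) the
θ-cycle Proposition + the descent §3.3. (T4) is this seat's kernel theorem `ThetaCycle.exists_coeff_ne_zero_of_legendreSym_eq`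
(p685354) and its product form (p685927). THIS FILE does the DESCENT in the kernel and packages (T1)+(T2)+(T3) as ONE hypothesis
in `q`-expansion currency — for each auxiliary prime `r ∉ {2, p}` and `e ≤ 1`: a field `𝔽` of characteristic `p` with
`ι : ℤ_p → 𝔽`, a family `M j ⊆ 𝔽⟦q⟧` with filtration `w` and `Θ = q d/dq` satisfying the five Katz hypotheses of the engine, and
`G, T ∈ 𝔽⟦q⟧` with `G·T ∈ M (k + (p+1)/2)`, `T ≠ 0` supported on exponents `≡ 0 (mod p)` (`θ₀(q^{pQ²})`), `G` supported on the
`m`-CUT := {`n = m n'` : `n' ≡ 3 (4)`; `J(−n' | q) = 1` for odd primes `q ∣ m`; `n' ≡ 7 (8)` if `2 ∣ m`; `r^e ∥ n'`} and, ON the cut,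
the DICTIONARY «`coeff (m·n₀·f²) G = t·ι(x)` with `t ∈ ℤ`, `x ∈ ℤ_p`, `x = k⁻¹ B_{k,(χ↑ε_K↑)~}` for any imaginary quadratic `K` of
discriminant `−n₀` with Kronecker character `ε_K`, and `t = 1` when `f = 1`» — and proves **`stub_atP` ⟸ that hypothesis**
(`atP_six_of_cutForm`, conclusion = the registered signature VERBATIM). Proof (`atP_of_cutForm`): the seed `K₀` (`d₀ = −n₀`,
fundamental and odd) picks the auxiliary datum — `(3, 0)` if `3 ∤ n₀`, else `(r, 1)` for a prime `r ≥ 5`, `r ≠ p`, `r ∣ n₀`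
(`exists_prime_dvd_of_three_dvd`; this excludes `d = −3` without Dirichlet's theorem) —; `m·n₀` lies in the cut (splitting ⟺
Jacobi / `mod 8` criteria), so the unit field factor makes `coeff (m n₀) G ≠ 0`, `G ≠ 0`; the engine on `G·T` gives an index `a` in
the cut with `(a/p) = −(m/p)` and `coeff a G ≠ 0`; `a = m·n₁·f²` with `n₁` squarefree `≡ 3 (4)` (`Nat.sq_mul_squarefree_of_pos`,
parities mod `4`/`8`), `K := ℚ(√−n₁)` with its Kronecker character: every odd `q ∣ m` splits (`J(−n₁f² | q) = 1 ⟹ J(−n₁ | q) = 1`),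
`2` splits if `2 ∣ m`, `p` splits (`(n₁/p) = −1`, `(−n₁/p) = 1` as `p ≡ 3 (4)`), `−n₁ < −4` by the auxiliary condition, and the
dictionary's `ι(x) ≠ 0` is a unit field factor. NOTHING is discharged: the hypothesis is the typing item (Cohen–Eisenstein series,
`U_m` and twists, `θ₀`, Katz's theorems — none in Mathlib); what the kernel now certifies is that (AtP⁶) needs no idea beyond those
printed facts. beyond-print theorem: NO.

References: [Cohen1975] Thm. 3.1; [Katz1977] Thm. (1)–(2); [Katz1973] §4.4; [AhlgrenBoylan2003] Thm. 3; [Marcus2018] Ch. 2 Thm. 1,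
Ch. 3 Thm. 25; [Cox2013] Lemma 1.14; crux notes `Lines/eisenstein-resource-bdp-line-lead-g12.md` §§3.1–3.4, 8.
-/

set_option autoImplicit false
-- summit-side namespace `Summit.BirchSwinnertonDyer.BirchSwinnertonDyer.…` (single-conjunct summit, D-0017 layout)
set_option linter.dupNamespace false

noncomputable section

open scoped Classical NumberTheorySymbols
open NumberField DirichletCharacter Literature.NumberTheory.LFunctions
  Literature.NumberTheory.EllipticCurves Literature.NumberTheory.EllipticCurves.KrizLi2019
  Literature.NumberTheory.QuadraticFields

namespace Summit.BirchSwinnertonDyer.BirchSwinnertonDyer.Theorems.PrintCFram.ThetaCycle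

open Summit.BirchSwinnertonDyer.BirchSwinnertonDyer.Theorems.PrintCFram
open PowerSeries

/-! ## §5 Small arithmetic: parities of `f² n₁`, an auxiliary prime, units of `ℤ_p` under a map to characteristic `p` -/

/-- `f² · n₁ ≡ 3 (mod 4)` forces `f` odd and `n₁ ≡ 3 (mod 4)`; if moreover `f² n₁ ≡ 7 (mod 8)` then `n₁ ≡ 7 (mod 8)`. [folklore] -/
theorem mod_four_of_sq_mul {f n₁ : ℕ} (h4 : f ^ 2 * n₁ % 4 = 3) :
    f % 2 = 1 ∧ n₁ % 4 = 3 ∧ (f ^ 2 * n₁ % 8 = 7 → n₁ % 8 = 7) := by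
  have hsq8 : f ^ 2 % 8 = (f % 8) ^ 2 % 8 := Nat.pow_mod f 2 8
  have hprod4 : f ^ 2 * n₁ % 4 = (f ^ 2 % 4) * (n₁ % 4) % 4 := Nat.mul_mod _ _ _
  have hprod8 : f ^ 2 * n₁ % 8 = (f ^ 2 % 8) * (n₁ % 8) % 8 := Nat.mul_mod _ _ _
  have hf8 : f % 8 = 0 ∨ f % 8 = 1 ∨ f % 8 = 2 ∨ f % 8 = 3 ∨ f % 8 = 4 ∨ f % 8 = 5 ∨ f % 8 = 6 ∨
      f % 8 = 7 := by
    omega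
  have key : (f % 2 = 1 ∧ f ^ 2 % 8 = 1) ∨ (f % 2 = 0 ∧ f ^ 2 % 4 = 0) := by
    rcases hf8 with h | h | h | h | h | h | h | h <;> rw [h] at hsq8 <;> norm_num at hsq8 <;> omega
  rcases key with ⟨hodd, h8⟩ | ⟨-, h40⟩
  · have h4' : f ^ 2 % 4 = 1 := by omega
    rw [h4'] at hprod4
    rw [h8] at hprod8
    exact ⟨hodd, by omega, fun h => by omega⟩
  · rw [h40] at hprod4
    omega

/-- **An auxiliary prime.** If `n₀` is squarefree, `n₀ ≡ 3 (mod 4)`, `n₀ > 4` and `3 ∣ n₀`, then for any `p ≡ 3 (mod 4)` some prime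
`r ∉ {2, 3, p}` divides `n₀` (`n₀ = 3s`, `s ≥ 5` odd and prime to `3`; if `p ∣ s` then `s = pt` with `t ≡ 3 (mod 4)`, `t ≥ 7`).
Used to exclude `d = −3` from the cut by the condition `r ∥ n'` while keeping the seed `d₀ = −n₀`. [folklore] -/
theorem exists_prime_dvd_of_three_dvd {n₀ p : ℕ} (hsq : Squarefree n₀) (h4 : n₀ % 4 = 3) (hgt : 4 < n₀)
    (h3 : 3 ∣ n₀) (hp4 : p % 4 = 3) : ∃ r : ℕ, r.Prime ∧ r ≠ 2 ∧ r ≠ 3 ∧ r ≠ p ∧ r ∣ n₀ := by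
  obtain ⟨s, hs⟩ := h3
  have hs3 : ¬ 3 ∣ s := by
    rintro ⟨t, ht⟩
    have h := Nat.isUnit_iff.mp (hsq 3 ⟨t, by rw [hs, ht]; ring⟩)
    omega
  by_cases hps : p ∣ s
  · obtain ⟨t, ht⟩ := hps
    have hpt : ¬ p ∣ t := by
      rintro ⟨u, hu⟩
      have h := Nat.isUnit_iff.mp (hsq p ⟨3 * u, by rw [hs, ht, hu]; ring⟩)
      omega
    have ht3 : ¬ 3 ∣ t := fun ⟨u, hu⟩ => hs3 ⟨p * u, by rw [ht, hu]; ring⟩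
    have ht4 : t % 4 = 3 := by
      have h1 : n₀ % 4 = (3 * p % 4) * (t % 4) % 4 := by rw [hs, ht, ← mul_assoc, Nat.mul_mod]
      have h2 : 3 * p % 4 = 1 := by omega
      rw [h2] at h1
      omega
    have ht1 : t ≠ 1 := by omega
    have hmin := Nat.minFac_dvd t
    refine ⟨t.minFac, Nat.minFac_prime ht1, ?_, ?_, ?_, dvd_trans hmin ⟨3 * p, by rw [hs, ht]; ring⟩⟩
    · intro h
      rw [h] at hmin
      omega
    · intro h
      exact ht3 (h ▸ hmin)
    · intro h
      exact hpt (h ▸ hmin)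
  · have hs1 : s ≠ 1 := by omega
    have hmin := Nat.minFac_dvd s
    refine ⟨s.minFac, Nat.minFac_prime hs1, ?_, ?_, ?_, dvd_trans hmin ⟨3, by rw [hs]; ring⟩⟩
    · intro h
      rw [h] at hmin
      omega
    · intro h
      exact hs3 (h ▸ hmin)
    · intro h
      exact hps (h ▸ hmin)

/-- **A `p`-adic integer whose image in characteristic `p` is non-zero is a unit** (`‖x‖ ≤ p⁻¹ ⟹ p ∣ x ⟹ ι x = p·ι y = 0`); read on
`ℚ_p`: `¬ ‖x‖ ≤ p⁻¹`. [folklore] -/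
theorem not_norm_le_of_map_ne_zero {p : ℕ} [Fact p.Prime] {𝔽 : Type*} [Field 𝔽] [CharP 𝔽 p] (ι : ℤ_[p] →+* 𝔽)
    {x : ℤ_[p]} (hx : ι x ≠ 0) : ¬ ‖(x : ℚ_[p])‖ ≤ (p : ℝ)⁻¹ := by
  intro hle
  have hp1 : (1 : ℝ) < p := by exact_mod_cast (Fact.out : p.Prime).one_lt
  have hlt : ‖x‖ < 1 := by
    rw [PadicInt.norm_def]
    exact lt_of_le_of_lt hle (inv_lt_one_of_one_lt₀ hp1)
  obtain ⟨y, hy⟩ := (PadicInt.norm_lt_one_iff_dvd x).mp hlt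
  apply hx
  rw [hy, map_mul, map_natCast, CharP.cast_eq_zero, zero_mul]

/-- **A `p`-adic integer of norm `> p⁻¹` is a unit, so its image under any ring map to a field is non-zero.** [folklore] -/
theorem map_ne_zero_of_not_norm_le {p : ℕ} [Fact p.Prime] {𝔽 : Type*} [Field 𝔽] (ι : ℤ_[p] →+* 𝔽)
    {x : ℤ_[p]} (hx : ¬ ‖(x : ℚ_[p])‖ ≤ (p : ℝ)⁻¹) : ι x ≠ 0 := by
  have hunit : IsUnit x := by
    rw [PadicInt.isUnit_iff]
    by_contra hne
    have hlt : ‖x‖ < 1 := lt_of_le_of_ne (PadicInt.norm_le_one x) hne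
    obtain ⟨y, hy⟩ := (PadicInt.norm_lt_one_iff_dvd x).mp hlt
    apply hx
    rw [PadicInt.padic_norm_e_of_padicInt, hy, norm_mul, PadicInt.norm_p]
    exact mul_le_of_le_one_right (by positivity) (PadicInt.norm_le_one y)
  exact (hunit.map ι).ne_zero

/-! ## §6 The descent: `stub_atP` ⟸ the cut form -/

/-- **(AtP⁶) for one class datum ⟸ the cut-form hypothesis.** For `p ≥ 7`, `p ≡ 3 (mod 4)`, `m ⊥ p`, a Dirichlet character `χ`
mod `m` with values in `ℚ_p`, `k ∈ {(p+1)/4, (3p−1)/4}`: ASSUME (`hcut`) that for every prime `r ∉ {2, p}` and `e ≤ 1` there are a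
field `𝔽` of characteristic `p`, a ring map `ι : ℤ_p → 𝔽`, a family `M j ⊆ 𝔽⟦q⟧` with filtration `w` and an operator `Θ` acting as
`q d/dq` satisfying the five hypotheses of `ThetaCycle.exists_coeff_ne_zero_of_legendreSym_eq` [Katz1973 §4.4, Katz1977 Thm. (1)–(2)],
and `G, T ∈ 𝔽⟦q⟧` with `G·T ∈ M (k + (p+1)/2)`, `T ≠ 0` supported on exponents divisible by `p`, `G` supported on the `m`-cut with
auxiliary condition `r^e ∥ n'`, and on the cut the dictionary `coeff (m n₀ f²) G = t · ι x`, `x = k⁻¹ B_{k,(χ↑ε_K↑)~}` (`t = 1` if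
`f = 1`) for imaginary quadratic `K` of discriminant `−n₀` [Cohen1975 Thm. 3.1: the `m`-cut Cohen–Eisenstein series `× θ₀(Q²z)^p`,
reduced mod `p`]. THEN a unit field factor at some imaginary quadratic `K₀` (`d_{K₀}` odd `< −4`, every prime of `m` split) yields an
imaginary quadratic `K` with every prime of `p·m` split, `d_K` odd `< −4`, and unit field factor — the conclusion of registry v21's
`stub_atP`. Kernel: the engine (p685354/p685927) + the descent of lead-g12 §3.3. Nothing about BSD. [Cohen1975, Thm. 3.1]
[Katz1977, Thm. (1)–(2)] [Marcus2018, Ch. 3 Thm. 25] [Cox2013, §1.C Lemma 1.14] -/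
theorem atP_of_cutForm (p : ℕ) [Fact p.Prime] (m : ℕ) [NeZero m] (χ : DirichletCharacter ℚ_[p] m) (k : ℕ)
    (h7 : 7 ≤ p) (hp4 : p % 4 = 3) (hmp : m.Coprime p) (hk : k = (p + 1) / 4 ∨ k = (3 * p - 1) / 4)
    (hcut : ∀ (r e : ℕ), r.Prime → r ≠ 2 → r ≠ p → e ≤ 1 →
      ∃ (𝔽 : Type) (_ : Field 𝔽) (_ : CharP 𝔽 p) (ι : ℤ_[p] →+* 𝔽)
        (M : ℕ → Submodule 𝔽 (PowerSeries 𝔽)) (w : PowerSeries 𝔽 → ℕ) (Θ : PowerSeries 𝔽 →ₗ[𝔽] PowerSeries 𝔽)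
        (G T : PowerSeries 𝔽),
        (∀ (g : PowerSeries 𝔽) (n : ℕ), coeff n (Θ g) = (n : 𝔽) * coeff n g) ∧
        (∀ (g : PowerSeries 𝔽) (j : ℕ), g ∈ M j → g ≠ 0 → w g ≤ j ∧ (p - 1) ∣ (j - w g)) ∧
        (∀ (g : PowerSeries 𝔽) (j : ℕ), g ∈ M j → g ≠ 0 → g ∈ M (w g)) ∧
        (∀ g ∈ M 0, g = C (constantCoeff g)) ∧
        (∀ (g : PowerSeries 𝔽) (j : ℕ), g ∈ M j → Θ g ∈ M (j + p + 1)) ∧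
        (∀ (g : PowerSeries 𝔽) (j : ℕ), g ∈ M j → g ≠ 0 → ¬ p ∣ w g → Θ g ≠ 0 ∧ w (Θ g) = w g + p + 1) ∧
        G * T ∈ M (k + (p + 1) / 2) ∧ T ≠ 0 ∧ (∀ j : ℕ, coeff j T ≠ 0 → p ∣ j) ∧
        (∀ a : ℕ, coeff a G ≠ 0 →
          m ∣ a ∧ a / m % 4 = 3 ∧ (∀ q : ℕ, q.Prime → q ∣ m → q ≠ 2 → jacobiSym (-((a / m : ℕ) : ℤ)) q = 1) ∧
            (2 ∣ m → a / m % 8 = 7) ∧ r ^ e ∣ a / m ∧ ¬ r ^ (e + 1) ∣ a / m) ∧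
        (∀ (n₀ f : ℕ) (K : Type) [Field K] [NumberField K] (εK : DirichletCharacter ℚ_[p] (NumberField.discr K).natAbs),
          Squarefree n₀ → n₀ % 4 = 3 → 0 < f →
          (m ∣ m * (n₀ * f ^ 2) ∧ m * (n₀ * f ^ 2) / m % 4 = 3 ∧
            (∀ q : ℕ, q.Prime → q ∣ m → q ≠ 2 → jacobiSym (-((m * (n₀ * f ^ 2) / m : ℕ) : ℤ)) q = 1) ∧
            (2 ∣ m → m * (n₀ * f ^ 2) / m % 8 = 7) ∧ r ^ e ∣ m * (n₀ * f ^ 2) / m ∧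
            ¬ r ^ (e + 1) ∣ m * (n₀ * f ^ 2) / m) →
          IsImaginaryQuadratic K → NumberField.discr K = -(n₀ : ℤ) → IsKroneckerCharacterOf K εK →
          ∃ (t : ℤ) (x : ℤ_[p]), (f = 1 → t = 1) ∧
            (x : ℚ_[p]) = (k : ℚ_[p])⁻¹ * @generalizedBernoulli ℚ_[p] _ _
              (changeLevel (dvd_mul_right m (NumberField.discr K).natAbs) χ *
                changeLevel (dvd_mul_left (NumberField.discr K).natAbs m) εK).conductor ⟨conductor_ne_zero _⟩ k
              (changeLevel (dvd_mul_right m (NumberField.discr K).natAbs) χ *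
                changeLevel (dvd_mul_left (NumberField.discr K).natAbs m) εK).primitiveCharacter ∧
            coeff (m * (n₀ * f ^ 2)) G = (t : 𝔽) * ι x))
    (K₀ : Type) [Field K₀] [NumberField K₀] (ε₀ : DirichletCharacter ℚ_[p] (NumberField.discr K₀).natAbs)
    (hK₀ : IsImaginaryQuadratic K₀)
    (hsplit₀ : ∀ q : ℕ, q.Prime → q ∣ m → ((Ideal.span {(q : ℤ)}).primesOver (𝓞 K₀)).ncard = 2)
    (hodd₀ : Odd (NumberField.discr K₀)) (hlt₀ : NumberField.discr K₀ < -4) (hε₀ : IsKroneckerCharacterOf K₀ ε₀)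
    (hunit₀ : ¬ ‖(k : ℚ_[p])⁻¹ * @generalizedBernoulli ℚ_[p] _ _
            (changeLevel (dvd_mul_right m (NumberField.discr K₀).natAbs) χ *
              changeLevel (dvd_mul_left (NumberField.discr K₀).natAbs m) ε₀).conductor ⟨conductor_ne_zero _⟩ k
            (changeLevel (dvd_mul_right m (NumberField.discr K₀).natAbs) χ *
              changeLevel (dvd_mul_left (NumberField.discr K₀).natAbs m) ε₀).primitiveCharacter‖ ≤ (p : ℝ)⁻¹) :
    ∃ (K : Type) (_ : Field K) (_ : NumberField K) (εK : DirichletCharacter ℚ_[p] (NumberField.discr K).natAbs),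
      IsImaginaryQuadratic K ∧
      (∀ q : ℕ, q.Prime → q ∣ p * m → ((Ideal.span {(q : ℤ)}).primesOver (𝓞 K)).ncard = 2) ∧
      Odd (NumberField.discr K) ∧ NumberField.discr K < -4 ∧ IsKroneckerCharacterOf K εK ∧
      ¬ ‖(k : ℚ_[p])⁻¹ * @generalizedBernoulli ℚ_[p] _ _
          (changeLevel (dvd_mul_right m (NumberField.discr K).natAbs) χ *
            changeLevel (dvd_mul_left (NumberField.discr K).natAbs m) εK).conductor ⟨conductor_ne_zero _⟩ k
          (changeLevel (dvd_mul_right m (NumberField.discr K).natAbs) χ *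
            changeLevel (dvd_mul_left (NumberField.discr K).natAbs m) εK).primitiveCharacter‖ ≤ (p : ℝ)⁻¹ := by
  have hpp : p.Prime := Fact.out
  have hp2 : p ≠ 2 := by omega
  have hm0 : 0 < m := Nat.pos_of_ne_zero (NeZero.ne m)
  have hpm : ¬ p ∣ m := fun h => by
    have := Nat.Coprime.eq_one_of_dvd (Nat.Coprime.symm hmp) h
    omega
  -- §a the seed discriminant `d₀ = −n₀`: odd, fundamental, `n₀ ≡ 3 (4)`, `n₀ ≥ 7`, squarefree
  have h2₀ : Module.finrank ℚ K₀ = 2 := hK₀.1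
  obtain ⟨n₀, hn₀⟩ : ∃ n₀ : ℕ, (NumberField.discr K₀).natAbs = n₀ := ⟨_, rfl⟩
  have hd₀ : NumberField.discr K₀ = -(n₀ : ℤ) := by
    rw [← hn₀, Int.natCast_natAbs, abs_of_neg (by omega), neg_neg]
  have hd₀4 : NumberField.discr K₀ % 4 = 1 ∧ Squarefree (NumberField.discr K₀) := by
    rcases Quadratic.isFundamentalDiscriminant_discr (K := K₀) h2₀ with ⟨h1, hsf, -⟩ | ⟨⟨c, hc⟩, -, -⟩
    · exact ⟨h1, hsf⟩
    · exfalso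
      rw [Int.odd_iff] at hodd₀
      omega
  have hn₀4 : n₀ % 4 = 3 := by
    have h := hd₀4.1
    rw [hd₀] at h
    omega
  have hn₀7 : 4 < n₀ := by
    have h := hlt₀
    rw [hd₀] at h
    omega
  have hn₀sq : Squarefree n₀ := by
    rw [← hn₀]
    exact Int.squarefree_natAbs.mpr hd₀4.2
  -- §b the auxiliary datum `(r, e)`: `(3, 0)` if `3 ∤ n₀`, else `(r, 1)` with `r ≥ 5`, `r ≠ p`, `r ∣ n₀`
  obtain ⟨r, e, hr, hr2, hrp, he, hre, h_e0, h_e1⟩ : ∃ r e : ℕ, r.Prime ∧ r ≠ 2 ∧ r ≠ p ∧ e ≤ 1 ∧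
      (r ^ e ∣ n₀ ∧ ¬ r ^ (e + 1) ∣ n₀) ∧ (e = 0 → r = 3) ∧ (e = 1 → r ≠ 3) := by
    by_cases h3 : 3 ∣ n₀
    · obtain ⟨r, hr, hr2, hr3, hrp, hrn⟩ := exists_prime_dvd_of_three_dvd hn₀sq hn₀4 hn₀7 h3 hp4
      refine ⟨r, 1, hr, hr2, hrp, le_rfl, ⟨by simpa using hrn, fun h => ?_⟩, by omega, fun _ => hr3⟩
      have h' : r * r ∣ n₀ := by simpa [pow_succ] using h
      exact hr.one_lt.ne' (Nat.isUnit_iff.mp (hn₀sq r h'))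
    · exact ⟨3, 0, Nat.prime_three, by omega, by omega, by omega, ⟨by simp, by simpa using h3⟩, fun _ => rfl,
        by omega⟩
  -- §c the cut form for `(r, e)`
  obtain ⟨𝔽, instF, instC, ι, M, w, Θ, G, T, hΘ, hfil, hfil_mem, hM0, hΘ_mem, hKatz, hGT, hT0, hTp, hsupp, hdict⟩ :=
    hcut r e hr hr2 hrp he
  -- §d the seed lies in the cut, so `G ≠ 0`; and `a_G(0) = 0`
  have hcut₀ : m ∣ m * (n₀ * 1 ^ 2) ∧ m * (n₀ * 1 ^ 2) / m % 4 = 3 ∧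
      (∀ q : ℕ, q.Prime → q ∣ m → q ≠ 2 → jacobiSym (-((m * (n₀ * 1 ^ 2) / m : ℕ) : ℤ)) q = 1) ∧
      (2 ∣ m → m * (n₀ * 1 ^ 2) / m % 8 = 7) ∧ r ^ e ∣ m * (n₀ * 1 ^ 2) / m ∧
      ¬ r ^ (e + 1) ∣ m * (n₀ * 1 ^ 2) / m := by
    have hdiv : m * (n₀ * 1 ^ 2) / m = n₀ := by
      rw [one_pow, mul_one, Nat.mul_div_cancel_left _ hm0]
    rw [hdiv]
    refine ⟨dvd_mul_right _ _, hn₀4, fun q hq hqm hq2 => ?_, fun h2m => ?_, hre.1, hre.2⟩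
    · rw [← hd₀]
      exact (Quadratic.ncard_primesOver_eq_two_iff_jacobiSym h2₀ hq hq2).mp (hsplit₀ q hq hqm)
    · have h := (Quadratic.ncard_primesOver_two_eq_two_iff h2₀).mp (by simpa using hsplit₀ 2 Nat.prime_two h2m)
      rw [hd₀] at h
      omega
  obtain ⟨t₀, x₀, ht₀, hx₀, hc₀⟩ := hdict n₀ 1 K₀ ε₀ hn₀sq hn₀4 one_pos hcut₀ hK₀ hd₀ hε₀
  have hx₀u : ι x₀ ≠ 0 := by
    refine map_ne_zero_of_not_norm_le ι ?_
    rw [hx₀]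
    exact hunit₀
  have hG : G ≠ 0 := by
    intro hG
    rw [hG, map_zero, ht₀ rfl, Int.cast_one, one_mul] at hc₀
    exact hx₀u hc₀.symm
  have hG0 : constantCoeff G = 0 := by
    by_contra hne
    rw [← coeff_zero_eq_constantCoeff_apply] at hne
    have h := (hsupp 0 hne).2.1
    rw [Nat.zero_div] at h
    omega
  -- §e the engine: a non-zero coefficient of `G` in the Legendre class `−(m/p)`
  have hlegm : legendreSym p m = 1 ∨ legendreSym p m = -1 := legendreSym_natCast_eq_one_or_eq_neg_one hpm
  have hε : -legendreSym p m = 1 ∨ -legendreSym p m = -1 := by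
    rcases hlegm with h | h <;> rw [h] <;> norm_num
  obtain ⟨a, haleg, ha⟩ := exists_coeff_ne_zero_of_legendreSym_eq_of_mul_mem (𝔽 := 𝔽) h7 hp4 M w Θ hΘ hfil
    hfil_mem hM0 hΘ_mem hKatz hk hGT hG hG0 hT0 hTp hε
  -- §f the index `a = m · n₁ · f²`, `n₁` squarefree `≡ 3 (4)`, `n₁ ≥ 7`
  obtain ⟨hma, ha4, -, -, hare, hare'⟩ := hsupp a ha
  have hn'0 : 0 < a / m := Nat.pos_of_ne_zero fun h => by rw [h] at ha4; norm_num at ha4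
  obtain ⟨n₁, f, hn₁0, hf0, hfn, hn₁sq⟩ := Nat.sq_mul_squarefree_of_pos hn'0
  obtain ⟨-, hn₁4, hn₁8⟩ := mod_four_of_sq_mul (f := f) (n₁ := n₁) (by rw [hfn]; exact ha4)
  have han₁ : a = m * (n₁ * f ^ 2) := by
    rw [mul_comm n₁ (f ^ 2), hfn, Nat.mul_div_cancel' hma]
  have hn₁3 : n₁ ≠ 3 := by
    intro h3
    rcases Nat.eq_zero_or_pos e with he0 | he1
    · apply hare'
      rw [he0, h_e0 he0, ← hfn, h3]
      exact ⟨f ^ 2, by ring⟩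
    · have he1' : e = 1 := by omega
      have hr3 : r ≠ 3 := h_e1 he1'
      rw [he1'] at hare hare'
      have hr' : r ∣ f ^ 2 * 3 := by
        rw [h3] at hfn
        rw [pow_one, ← hfn] at hare
        exact hare
      have hcop : Nat.Coprime r 3 := (Nat.coprime_primes hr Nat.prime_three).mpr hr3
      have hrf : r ∣ f := hr.dvd_of_dvd_pow (hcop.dvd_of_dvd_mul_right hr')
      apply hare'
      rw [← hfn]
      exact Dvd.dvd.mul_right (pow_dvd_pow_of_dvd hrf 2) _
  have hn₁7 : 4 < n₁ := by omega
  -- §g the cut conditions at `a = m · (n₁ f²)`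
  have ha' : coeff (m * (n₁ * f ^ 2)) G ≠ 0 := han₁ ▸ ha
  have hcut₁ := hsupp _ ha'
  obtain ⟨-, -, hJ', h8', -, -⟩ := hsupp _ ha'
  have hdiv : m * (n₁ * f ^ 2) / m = n₁ * f ^ 2 := Nat.mul_div_cancel_left _ hm0
  rw [hdiv] at hJ' h8'
  have hJq : ∀ q : ℕ, q.Prime → q ∣ m → q ≠ 2 → jacobiSym (-(n₁ : ℤ)) q = 1 := by
    intro q hq hqm hq2
    have h := hJ' q hq hqm hq2
    have hcast : (-((n₁ * f ^ 2 : ℕ) : ℤ)) = (-(n₁ : ℤ)) * (f : ℤ) ^ 2 := by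
      push_cast
      ring
    rw [hcast, jacobiSym.mul_left, jacobiSym.pow_left] at h
    rcases jacobiSym.trichotomy (f : ℤ) q with h0 | h0 | h0
    · rw [h0] at h
      norm_num at h
    · rw [h0] at h
      simpa using h
    · rw [h0] at h
      simpa using h
  have hn₁8' : 2 ∣ m → n₁ % 8 = 7 := fun h2m => hn₁8 (by rw [mul_comm]; exact h8' h2m)
  -- §h the Legendre class: `(n₁/p) = −1`, so `p` splits in `ℚ(√−n₁)`
  have hcast : ((a : ℕ) : ℤ) = (m : ℤ) * ((n₁ : ℤ) * (f : ℤ) ^ 2) := by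
    rw [han₁]
    push_cast
    ring
  rw [hcast, legendreSym.mul, legendreSym.mul] at haleg
  have hf2 : legendreSym p ((f : ℤ) ^ 2) = 1 := by
    by_cases hf0' : ((f : ℤ) : ZMod p) = 0
    · exfalso
      have h0 : legendreSym p ((f : ℤ) ^ 2) = 0 := (legendreSym.eq_zero_iff p _).mpr (by
        have h := hf0'
        push_cast at h ⊢
        simp [h])
      rw [h0, mul_zero, mul_zero] at haleg
      rcases hlegm with h | h <;> rw [h] at haleg <;> norm_num at haleg
    · exact legendreSym.sq_one' p hf0'
  rw [hf2, mul_one] at haleg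
  have hn₁leg : legendreSym p n₁ = -1 := by
    rcases hlegm with h | h <;> rw [h] at haleg <;> linarith
  have hJp : jacobiSym (-(n₁ : ℤ)) p = 1 := by
    rw [← neg_one_mul, jacobiSym.mul_left, jacobiSym.at_neg_one (hpp.odd_of_ne_two hp2),
      ZMod.χ₄_nat_three_mod_four hp4, ← jacobiSym.legendreSym.to_jacobiSym, hn₁leg]
    norm_num
  -- §i the field `K = ℚ(√−n₁)`, its Kronecker character, and the dictionary
  have hsqZ : Squarefree (-(n₁ : ℤ)) := by
    rw [← Int.squarefree_natAbs, Int.natAbs_neg, Int.natAbs_natCast]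
    exact hn₁sq
  obtain ⟨K, iF, iN, h2, hd⟩ := Quadratic.exists_numberField_discr_eq (D := -(n₁ : ℤ))
    (Or.inl ⟨by omega, hsqZ, by omega⟩)
  have hKim : IsImaginaryQuadratic K := isImaginaryQuadratic_of_discr_eq_of_neg h2 hd (by omega)
  obtain ⟨εK, hεK, -⟩ :=
    KrizLiBinders.exists_isKroneckerCharacterOf_of_discr (p := p) h2 (m := n₁) hn₁sq (Or.inr ⟨hd, hn₁4⟩)
  obtain ⟨t, x, -, hx, hc⟩ := hdict n₁ f K εK hn₁sq hn₁4 hf0 hcut₁ hKim hd hεK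
  have hxu : ι x ≠ 0 := by
    intro h0
    apply ha'
    rw [hc, h0, mul_zero]
  refine ⟨K, iF, iN, εK, hKim, ?_, ?_, ?_, hεK, ?_⟩
  · intro q hq hqpm
    rcases (Nat.Prime.dvd_mul hq).mp hqpm with hqp | hqm
    · have hq_eq : q = p := (Nat.prime_dvd_prime_iff_eq hq hpp).mp hqp
      rw [hq_eq, Quadratic.ncard_primesOver_eq_two_iff_jacobiSym h2 hpp hp2, hd]
      exact hJp
    · by_cases hq2 : q = 2
      · subst hq2
        have h8 : NumberField.discr K % 8 = 1 := by
          rw [hd]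
          have := hn₁8' hqm
          omega
        simpa using (Quadratic.ncard_primesOver_two_eq_two_iff h2).mpr h8
      · rw [Quadratic.ncard_primesOver_eq_two_iff_jacobiSym h2 hq hq2, hd]
        exact hJq q hq hqm hq2
  · rw [hd, Int.odd_iff]
    omega
  · rw [hd]
    omega
  · rw [← hx]
    exact not_norm_le_of_map_ne_zero ι hxu

end Summit.BirchSwinnertonDyer.BirchSwinnertonDyer.Theorems.PrintCFram.ThetaCycle

end
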